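import Mathlib
import Summits.Ventures.HodgeRepro2.HolomorphicFiniteDimensional
import Summits.Ventures.HodgeRepro2.MultiplicityOnePeriod

/-!
# HolomorphicFiniteBasis — a finite basis of holomorphic weight-`k` forms on the compact Picard
modular surface, at the level of functions on the ball

Blind cell `pub-hodge-repro2`, seat p2 (Tier 5 kernel support).

`HolomorphicFiniteDimensional.lean` proved that the holomorphic part of the Petersson space is
finite-dimensional. Read at the level of functions on the ball: there are finitely many
holomorphic weight-`k` forms `f₁, …, f_n` for `S` (`n = finrank` of the holomorphic part) such that
every holomorphic weight-`k` form for `S` agrees ON THE BALL with a linear combination of them —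
«`S_k(Γ)` is spanned by finitely many forms», with the identification of forms that agree on the
ball (`PeterssonSpace.mk_eq_mk_iff`).
-/

namespace Summit.Ventures.HodgeRepro2.ShimuraData

open MeasureTheory

variable {K : Type*} [Field K] [NumberField K] [NumberField.IsCMField K] {τ₁ : K →+* ℂ}
  {H : Matrix (Fin 3) (Fin 3) K} {Q : Matrix (Fin 3) (Fin 3) ℂ} (hQ : IsFrame K τ₁ H Q)
  (S : Subgroup (GL (Fin 3) K)) (hS : (S : Set (GL (Fin 3) K)) ⊆ unitaryGroup K H)
  [CompactSpace (ballQuotient hQ S hS)] {D : Set ball₂} (k : ℕ)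
  (hD : IsBallFundamentalDomain hQ S hS D)

/-- **A finite spanning family of holomorphic weight-`k` forms.** For a compact quotient with `S`
acting properly discontinuously and a fundamental domain `D`, there are `n` holomorphic weight-`k`
forms `f i` for `S` (`n` = the dimension of the holomorphic part of the Petersson space) such that
every holomorphic weight-`k` form `g` for `S` agrees on the ball with a linear combination
`∑ i, c i • f i`. -/
theorem exists_finite_spanning_holomorphicForms
    (hpd : @ProperlyDiscontinuousSMul S ball₂ _ (frameAction hQ S hS).toSMul) :
    ∃ (n : ℕ) (f : Fin n → PeterssonForms hQ S hS k hD),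
      (∀ i, f i ∈ holomorphicForms hQ S hS k hD) ∧
      ∀ g ∈ holomorphicForms hQ S hS k hD, ∃ c : Fin n → ℂ, ∀ z ∈ ball₂,
        (PeterssonForms.toForm hQ S hS k hD g : (Fin 2 → ℂ) → ℂ) z
          = ∑ i, c i * (PeterssonForms.toForm hQ S hS k hD (f i) : (Fin 2 → ℂ) → ℂ) z := by
  haveI : FiniteDimensional ℂ (holomorphicSpace hQ S hS k hD) :=
    finiteDimensional_holomorphicSpace hQ S hS k hD hpd
  let b := Module.finBasis ℂ (holomorphicSpace hQ S hS k hD)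
  refine ⟨Module.finrank ℂ (holomorphicSpace hQ S hS k hD),
    fun i => holRep hQ S hS k hD (b i), fun i => holRep_mem hQ S hS k hD (b i), ?_⟩
  intro g hg
  set v : holomorphicSpace hQ S hS k hD :=
    ⟨SeparationQuotient.mk g, mk_mem_holomorphicSpace hQ S hS k hD hg⟩ with hvdef
  refine ⟨fun i => b.repr v i, ?_⟩
  have hcoe : (v : PeterssonSpace hQ S hS k hD)
      = ∑ i, b.repr v i • (b i : PeterssonSpace hQ S hS k hD) := by
    conv_lhs => rw [← b.sum_repr v]
    simp only [Submodule.coe_sum, Submodule.coe_smul]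
  have hmk : ∀ i, (b i : PeterssonSpace hQ S hS k hD)
      = SeparationQuotient.mk (holRep hQ S hS k hD (b i)) :=
    fun i => (mk_holRep hQ S hS k hD (b i)).symm
  have hmksum : (SeparationQuotient.mk (∑ i, b.repr v i • holRep hQ S hS k hD (b i)) :
      PeterssonSpace hQ S hS k hD)
      = ∑ i, b.repr v i • (SeparationQuotient.mk (holRep hQ S hS k hD (b i)) :
          PeterssonSpace hQ S hS k hD) := by
    change (SeparationQuotient.mkCLM ℂ (PeterssonForms hQ S hS k hD)) (∑ i, b.repr v i • holRep hQ S hS k hD (b i))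
      = ∑ i, b.repr v i • (SeparationQuotient.mkCLM ℂ (PeterssonForms hQ S hS k hD)) (holRep hQ S hS k hD (b i))
    simp only [map_sum, map_smul]
  have hsum : (SeparationQuotient.mk g : PeterssonSpace hQ S hS k hD)
      = SeparationQuotient.mk (∑ i, b.repr v i • holRep hQ S hS k hD (b i)) := by
    have h1 : (v : PeterssonSpace hQ S hS k hD) = SeparationQuotient.mk g := rfl
    rw [← h1, hcoe, hmksum]
    simp only [hmk]
  rw [PeterssonSpace.mk_eq_mk_iff] at hsum
  intro z hz
  rw [hsum z hz]
  show ((∑ i, b.repr v i • holRep hQ S hS k hD (b i) : weightForms τ₁ Q S k) : (Fin 2 → ℂ) → ℂ) z = _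
  simp only [Submodule.coe_sum, Finset.sum_apply]
  rfl

end Summit.Ventures.HodgeRepro2.ShimuraData
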